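import Summits.CriticalPhenomena.PercolationContinuityZ3.Theorems.PercNearOneGluingNoHeavyQuantLongTailTripleHubAlg
import HarnessLib

/-!
# QUANT lane R8, T-DEC: LONG-TAIL TRIPLE HUB, `7lo/2 ≤ K ≤ 4lo` — the top route's floor cost at `T = 6lo+2K` (`Cc2`), box `[31/112, 9/31]` (census-1 gen 33)

builds on p205010 (kernel theorem, internal audit signed; external expert review pending)

Support file (`--supports stmt-CriticalPhenomena-4575`), QUANT lane seat prim-quant-census-1 (gen 33); memo
`run/shared/lean/prim/quant/prim-quant-census-1/g33/WIDE3-G33.md` §2.  Theorems only, standard axioms, no sorries.  Companion of `…QuantLongTailTripleTopAlgFour(Two)`: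
the twin, for `lo/K < 2/7`, of gen 32's `ltTop_cost2_max` (`…TripleTopAlgThree`, `lo/K ∈ [2/7, 1/3]`) — the left end of the two-low floor-cost quadratic
(`tripleWide4_costTopTwo`).  On the whole box `lo/K ∈ [1/4, 2/7]` the degree-6 Handelman LP is numerically delicate (HiGHS 'unknown' on `[31/112, 2/7]`,
no answer in 30 min on `[1/4, 2/7]`), so the range is covered by THREE boxes `[1/4, 15/56]`, `[15/56, 31/112]`, `[31/112, 9/31]` (one certificate each,
123 / 129 / 129 products, kit j298431 / j298478 / j298519, < 80 s each); the case split is `ltTopW_cost2_max` (`…QuantLongTailTripleTopAlgW4`).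
* `ltTop4_cost2_max_c` (`lo/K ∈ [31/112, 9/31]`); `…TopAlgFourThree` has the boxes `[1/4, 15/56]`, `[15/56, 31/112]`.

HONEST STATUS.  Algebra only; `SiblingStep`, `GluedDominatedMass`, `SDECConvClosed`, `FarTreeRow` OPEN; RATE class (log\*) / honest sentence of
`run/shared/lean/prim/quant/README.md` unchanged.  [this work].  Nothing here is cited as a published result.  The gluing rows served
[cite: KozmaNitzan2024, Conjecture 3 (p. 15)]; product measure [cite: Grimmett1999, §1.3 p. 10].
-/

noncomputable section

namespace Summit.CriticalPhenomena.PercolationContinuityZ3.Theorems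
namespace Quant
namespace LawDec

set_option maxRecDepth 4096 in
/-- **top cost, floor part, at `T = 6lo+2K`, largest floor, `lo/K ∈ [31/112, 9/31]`** (`g₁` the least gate, `2K ≤ K(g₁+g₂+g₃) − 3lo`):
`(K−3lo)(lo+Kg₁)(6lo+2K)(u₀+u₁) ≤ ((3lo+K(g₁+g₂+g₃))(lo+K) − (lo+Kg₁)(6lo+2K))·(u₀(3lo+2K)+u₁(3lo+K)+3lo·u₂)`; degree-6 certificate of
123 products (kit j298519). [this work] -/
theorem ltTop4_cost2_max_c (lo K g₁ g₂ g₃ : ℝ) (hlo : 0 < lo)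
    (hK1 : 31 * lo ≤ 9 * K) (hK2 : 31 * K ≤ 112 * lo) (hg₁ : lo ≤ K * g₁) (hg₂ : lo ≤ K * g₂) (hg₃ : lo ≤ K * g₃) (h12 : g₁ ≤ g₂)
    (h13 : g₁ ≤ g₃) (h11 : g₁ ≤ 1) (h21 : g₂ ≤ 1) (h31 : g₃ ≤ 1) (hL2' : 2 * K ≤ K * (g₁ + g₂ + g₃) - 3 * lo) :
    (K - 3 * lo) * (lo + K * g₁) * (6 * lo + 2 * K) * ((1 - g₁) * (1 - g₂) * (1 - g₃) + (g₁ * (1 - g₂) * (1 - g₃) + g₂ * (1 - g₁) * (1 - g₃)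
          + g₃ * (1 - g₁) * (1 - g₂)))
      ≤ ((3 * lo + K * (g₁ + g₂ + g₃)) * (lo + K) - (lo + K * g₁) * (6 * lo + 2 * K)) * ((1 - g₁) * (1 - g₂) * (1 - g₃) * (3 * lo + 2 * K) + (g₁ * (1
          - g₂) * (1 - g₃) + g₂ * (1 - g₁) * (1 - g₃) + g₃ * (1 - g₁) * (1 - g₂)) * (3 * lo + K) + (g₁ * g₂ * (1 - g₃) + g₁ * g₃ * (1 - g₂) + g₂ * g₃ * (1 - g₁)) * (3 * lo)) := by
  have hK : 0 < K := by linarith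
  have hA1 : 0 ≤ K * g₁ - lo := sub_nonneg.2 hg₁
  have hA2 : 0 ≤ K * g₂ - lo := sub_nonneg.2 hg₂
  have hA3 : 0 ≤ K * g₃ - lo := sub_nonneg.2 hg₃
  have hE1 : 0 ≤ 1 - g₁ := sub_nonneg.2 h11
  have hE2 : 0 ≤ 1 - g₂ := sub_nonneg.2 h21
  have hE3 : 0 ≤ 1 - g₃ := sub_nonneg.2 h31
  have h21' : 0 ≤ g₂ - g₁ := sub_nonneg.2 h12
  have h31' : 0 ≤ g₃ - g₁ := sub_nonneg.2 h13
  have hClo : 0 ≤ 112 * lo - 31 * K := by linarith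
  have hChi : 0 ≤ 9 * K - 31 * lo := by linarith
  have hL2 : 0 ≤ K * (g₁ + g₂ + g₃) - 3 * lo - 2 * K := by linarith
  have key : 0 ≤ K * (((3 * lo + K * (g₁ + g₂ + g₃)) * (lo + K) - (lo + K * g₁) * (6 * lo + 2 * K)) * ((1 - g₁) * (1 - g₂) * (1 - g₃) * (3 * lo
          + 2 * K) + (g₁ * (1 - g₂) * (1 - g₃) + g₂ * (1 - g₁) * (1 - g₃) + g₃ * (1 - g₁) * (1 - g₂)) * (3 * lo + K) + (g₁ * g₂ * (1
          - g₃) + g₁ * g₃ * (1 - g₂) + g₂ * g₃ * (1 - g₁)) * (3 * lo))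
      - ((K - 3 * lo) * (lo + K * g₁) * (6 * lo + 2 * K) * ((1 - g₁) * (1 - g₂) * (1 - g₃) + (g₁ * (1 - g₂) * (1 - g₃) + g₂ * (1 - g₁) * (1 - g₃)
          + g₃ * (1 - g₁) * (1 - g₂))))) := by
    linarith [mul_nonneg (mul_nonneg (mul_nonneg (mul_nonneg h31' hK.le) hK.le) hK.le) hK.le,
      mul_nonneg (mul_nonneg (mul_nonneg (mul_nonneg h31' hA3) hA3) hL2) hK.le,
      mul_nonneg (mul_nonneg (mul_nonneg (mul_nonneg h31' hA2) hL2) hL2) hL2,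
      mul_nonneg (mul_nonneg (mul_nonneg (mul_nonneg h31' hChi) hA3) hK.le) hK.le,
      mul_nonneg (mul_nonneg (mul_nonneg (mul_nonneg h31' hClo) hL2) hL2) hK.le,
      mul_nonneg (mul_nonneg (mul_nonneg (mul_nonneg (mul_nonneg h31' h31') hL2) hK.le) hK.le) hK.le,
      mul_nonneg (mul_nonneg (mul_nonneg (mul_nonneg (mul_nonneg h31' h31') hClo) hClo) hL2) hK.le,
      mul_nonneg (mul_nonneg (mul_nonneg (mul_nonneg h21' hK.le) hK.le) hK.le) hK.le,
      mul_nonneg (mul_nonneg (mul_nonneg (mul_nonneg h21' hA3) hL2) hL2) hL2,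
      mul_nonneg (mul_nonneg (mul_nonneg (mul_nonneg h21' hA2) hA2) hL2) hK.le,
      mul_nonneg (mul_nonneg (mul_nonneg (mul_nonneg h21' hChi) hA2) hK.le) hK.le,
      mul_nonneg (mul_nonneg (mul_nonneg (mul_nonneg h21' hClo) hL2) hL2) hK.le,
      mul_nonneg (mul_nonneg (mul_nonneg (mul_nonneg (mul_nonneg h21' h21') hL2) hK.le) hK.le) hK.le,
      mul_nonneg (mul_nonneg (mul_nonneg (mul_nonneg (mul_nonneg h21' h21') hClo) hClo) hL2) hK.le,
      mul_nonneg (mul_nonneg (mul_nonneg (mul_nonneg hE3 hL2) hK.le) hK.le) hK.le,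
      mul_nonneg (mul_nonneg (mul_nonneg (mul_nonneg hE3 hL2) hL2) hL2) hL2,
      mul_nonneg (mul_nonneg (mul_nonneg (mul_nonneg hE3 hA2) hA2) hK.le) hK.le,
      mul_nonneg (mul_nonneg (mul_nonneg (mul_nonneg hE3 hA2) hA2) hA2) hK.le,
      mul_nonneg (mul_nonneg (mul_nonneg (mul_nonneg hE3 hClo) hChi) hK.le) hK.le,
      mul_nonneg (mul_nonneg (mul_nonneg (mul_nonneg hE3 hClo) hClo) hChi) hK.le,
      mul_nonneg (mul_nonneg (mul_nonneg (mul_nonneg (mul_nonneg hE3 h31') hL2) hL2) hL2) hK.le,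
      mul_nonneg (mul_nonneg (mul_nonneg (mul_nonneg (mul_nonneg hE3 h31') hA3) hK.le) hK.le) hK.le,
      mul_nonneg (mul_nonneg (mul_nonneg (mul_nonneg (mul_nonneg hE3 h31') hClo) hK.le) hK.le) hK.le,
      mul_nonneg (mul_nonneg (mul_nonneg (mul_nonneg (mul_nonneg hE3 h21') hL2) hK.le) hK.le) hK.le,
      mul_nonneg (mul_nonneg (mul_nonneg (mul_nonneg (mul_nonneg hE3 h21') hA2) hK.le) hK.le) hK.le,
      mul_nonneg (mul_nonneg (mul_nonneg (mul_nonneg (mul_nonneg (mul_nonneg (mul_nonneg hE3 h21') h21') h31') hA2) hK.le) hK.le) hK.le,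
      mul_nonneg (mul_nonneg (mul_nonneg (mul_nonneg (mul_nonneg (mul_nonneg (mul_nonneg (mul_nonneg hE3 h21') h21') h21') h31') hK.le) hK.le) hK.le) hK.le,
      mul_nonneg (mul_nonneg (mul_nonneg (mul_nonneg (mul_nonneg (mul_nonneg (mul_nonneg hE3 hE3) h31') h31') hA3) hK.le) hK.le) hK.le,
      mul_nonneg (mul_nonneg (mul_nonneg (mul_nonneg (mul_nonneg (mul_nonneg hE3 hE3) h21') hL2) hL2) hK.le) hK.le,
      mul_nonneg (mul_nonneg (mul_nonneg (mul_nonneg (mul_nonneg (mul_nonneg hE3 hE3) hE3) hK.le) hK.le) hK.le) hK.le,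
      mul_nonneg (mul_nonneg (mul_nonneg (mul_nonneg (mul_nonneg (mul_nonneg hE3 hE3) hE3) hA3) hK.le) hK.le) hK.le,
      mul_nonneg (mul_nonneg (mul_nonneg (mul_nonneg (mul_nonneg (mul_nonneg (mul_nonneg hE3 hE3) hE3) hE3) hChi) hK.le) hK.le) hK.le,
      mul_nonneg (mul_nonneg (mul_nonneg (mul_nonneg hE2 hL2) hK.le) hK.le) hK.le,
      mul_nonneg (mul_nonneg (mul_nonneg (mul_nonneg hE2 hL2) hL2) hL2) hL2,
      mul_nonneg (mul_nonneg (mul_nonneg (mul_nonneg hE2 hA3) hA3) hA3) hK.le,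
      mul_nonneg (mul_nonneg (mul_nonneg (mul_nonneg hE2 hClo) hChi) hK.le) hK.le,
      mul_nonneg (mul_nonneg (mul_nonneg (mul_nonneg hE2 hClo) hClo) hChi) hK.le,
      mul_nonneg (mul_nonneg (mul_nonneg (mul_nonneg (mul_nonneg hE2 h31') hL2) hK.le) hK.le) hK.le,
      mul_nonneg (mul_nonneg (mul_nonneg (mul_nonneg (mul_nonneg hE2 h31') hA3) hK.le) hK.le) hK.le,
      mul_nonneg (mul_nonneg (mul_nonneg (mul_nonneg (mul_nonneg hE2 h21') hA2) hK.le) hK.le) hK.le,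
      mul_nonneg (mul_nonneg (mul_nonneg (mul_nonneg (mul_nonneg (mul_nonneg (mul_nonneg hE2 h21') h31') h31') hA3) hK.le) hK.le) hK.le,
      mul_nonneg (mul_nonneg (mul_nonneg (mul_nonneg (mul_nonneg (mul_nonneg (mul_nonneg (mul_nonneg hE2 h21') h31') h31') h31') hK.le) hK.le) hK.le) hK.le,
      mul_nonneg (mul_nonneg (mul_nonneg (mul_nonneg (mul_nonneg hE2 hE3) hChi) hL2) hK.le) hK.le,
      mul_nonneg (mul_nonneg (mul_nonneg (mul_nonneg (mul_nonneg hE2 hE3) hClo) hK.le) hK.le) hK.le,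
      mul_nonneg (mul_nonneg (mul_nonneg (mul_nonneg (mul_nonneg hE2 hE3) hClo) hChi) hL2) hK.le,
      mul_nonneg (mul_nonneg (mul_nonneg (mul_nonneg (mul_nonneg hE2 hE3) hClo) hClo) hK.le) hK.le,
      mul_nonneg (mul_nonneg (mul_nonneg (mul_nonneg (mul_nonneg hE2 hE3) hClo) hClo) hClo) hK.le,
      mul_nonneg (mul_nonneg (mul_nonneg (mul_nonneg (mul_nonneg (mul_nonneg hE2 hE2) h31') hL2) hL2) hK.le) hK.le,
      mul_nonneg (mul_nonneg (mul_nonneg (mul_nonneg (mul_nonneg (mul_nonneg (mul_nonneg hE2 hE2) h21') h21') hA2) hK.le) hK.le) hK.le,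
      mul_nonneg (mul_nonneg (mul_nonneg (mul_nonneg (mul_nonneg (mul_nonneg hE2 hE2) hE2) hK.le) hK.le) hK.le) hK.le,
      mul_nonneg (mul_nonneg (mul_nonneg (mul_nonneg (mul_nonneg (mul_nonneg hE2 hE2) hE2) hA2) hK.le) hK.le) hK.le,
      mul_nonneg (mul_nonneg (mul_nonneg (mul_nonneg (mul_nonneg (mul_nonneg (mul_nonneg hE2 hE2) hE2) hE2) hChi) hK.le) hK.le) hK.le,
      mul_nonneg (mul_nonneg (mul_nonneg (mul_nonneg hE1 hL2) hL2) hL2) hL2,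
      mul_nonneg (mul_nonneg (mul_nonneg (mul_nonneg hE1 hChi) hL2) hL2) hL2,
      mul_nonneg (mul_nonneg (mul_nonneg (mul_nonneg hE1 hClo) hL2) hL2) hK.le,
      mul_nonneg (mul_nonneg (mul_nonneg (mul_nonneg hE1 hClo) hChi) hK.le) hK.le,
      mul_nonneg (mul_nonneg (mul_nonneg (mul_nonneg hE1 hClo) hClo) hChi) hK.le,
      mul_nonneg (mul_nonneg (mul_nonneg (mul_nonneg hE1 hClo) hClo) hClo) hChi,
      mul_nonneg (mul_nonneg (mul_nonneg (mul_nonneg (mul_nonneg (mul_nonneg hE1 h31') h31') hChi) hL2) hK.le) hK.le,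
      mul_nonneg (mul_nonneg (mul_nonneg (mul_nonneg (mul_nonneg (mul_nonneg hE1 h31') h31') hClo) hClo) hK.le) hK.le,
      mul_nonneg (mul_nonneg (mul_nonneg (mul_nonneg (mul_nonneg (mul_nonneg hE1 h21') h21') hChi) hL2) hK.le) hK.le,
      mul_nonneg (mul_nonneg (mul_nonneg (mul_nonneg (mul_nonneg (mul_nonneg hE1 h21') h21') hClo) hClo) hK.le) hK.le,
      mul_nonneg (mul_nonneg (mul_nonneg (mul_nonneg (mul_nonneg hE1 hE3) hK.le) hK.le) hK.le) hK.le,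
      mul_nonneg (mul_nonneg (mul_nonneg (mul_nonneg (mul_nonneg hE1 hE3) hClo) hK.le) hK.le) hK.le,
      mul_nonneg (mul_nonneg (mul_nonneg (mul_nonneg (mul_nonneg hE1 hE3) hClo) hClo) hK.le) hK.le,
      mul_nonneg (mul_nonneg (mul_nonneg (mul_nonneg (mul_nonneg hE1 hE3) hClo) hClo) hClo) hK.le,
      mul_nonneg (mul_nonneg (mul_nonneg (mul_nonneg (mul_nonneg (mul_nonneg (mul_nonneg hE1 hE3) h31') h31') hL2) hK.le) hK.le) hK.le,
      mul_nonneg (mul_nonneg (mul_nonneg (mul_nonneg (mul_nonneg (mul_nonneg (mul_nonneg (mul_nonneg hE1 hE3) h31') h31') h31') hK.le) hK.le) hK.le) hK.le,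
      mul_nonneg (mul_nonneg (mul_nonneg (mul_nonneg (mul_nonneg (mul_nonneg (mul_nonneg hE1 hE3) hE3) h31') hK.le) hK.le) hK.le) hK.le,
      mul_nonneg (mul_nonneg (mul_nonneg (mul_nonneg (mul_nonneg (mul_nonneg (mul_nonneg hE1 hE3) hE3) h31') hClo) hK.le) hK.le) hK.le,
      mul_nonneg (mul_nonneg (mul_nonneg (mul_nonneg (mul_nonneg (mul_nonneg (mul_nonneg (mul_nonneg hE1 hE3) hE3) hE3) hE3) hK.le) hK.le) hK.le) hK.le,
      mul_nonneg (mul_nonneg (mul_nonneg (mul_nonneg (mul_nonneg hE1 hE2) hK.le) hK.le) hK.le) hK.le,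
      mul_nonneg (mul_nonneg (mul_nonneg (mul_nonneg (mul_nonneg hE1 hE2) hClo) hK.le) hK.le) hK.le,
      mul_nonneg (mul_nonneg (mul_nonneg (mul_nonneg (mul_nonneg hE1 hE2) hClo) hClo) hK.le) hK.le,
      mul_nonneg (mul_nonneg (mul_nonneg (mul_nonneg (mul_nonneg hE1 hE2) hClo) hClo) hClo) hK.le,
      mul_nonneg (mul_nonneg (mul_nonneg (mul_nonneg (mul_nonneg (mul_nonneg (mul_nonneg hE1 hE2) h21') h21') hL2) hK.le) hK.le) hK.le,
      mul_nonneg (mul_nonneg (mul_nonneg (mul_nonneg (mul_nonneg (mul_nonneg (mul_nonneg (mul_nonneg hE1 hE2) h21') h21') h21') hK.le) hK.le) hK.le) hK.le,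
      mul_nonneg (mul_nonneg (mul_nonneg (mul_nonneg (mul_nonneg (mul_nonneg hE1 hE2) hE3) hL2) hK.le) hK.le) hK.le,
      mul_nonneg (mul_nonneg (mul_nonneg (mul_nonneg (mul_nonneg (mul_nonneg hE1 hE2) hE3) hChi) hK.le) hK.le) hK.le,
      mul_nonneg (mul_nonneg (mul_nonneg (mul_nonneg (mul_nonneg (mul_nonneg hE1 hE2) hE3) hClo) hL2) hK.le) hK.le,
      mul_nonneg (mul_nonneg (mul_nonneg (mul_nonneg (mul_nonneg (mul_nonneg hE1 hE2) hE3) hClo) hChi) hK.le) hK.le,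
      mul_nonneg (mul_nonneg (mul_nonneg (mul_nonneg (mul_nonneg (mul_nonneg hE1 hE2) hE3) hClo) hClo) hL2) hK.le,
      mul_nonneg (mul_nonneg (mul_nonneg (mul_nonneg (mul_nonneg (mul_nonneg hE1 hE2) hE3) hClo) hClo) hChi) hK.le,
      mul_nonneg (mul_nonneg (mul_nonneg (mul_nonneg (mul_nonneg (mul_nonneg (mul_nonneg hE1 hE2) hE2) h21') hK.le) hK.le) hK.le) hK.le,
      mul_nonneg (mul_nonneg (mul_nonneg (mul_nonneg (mul_nonneg (mul_nonneg (mul_nonneg hE1 hE2) hE2) h21') hClo) hK.le) hK.le) hK.le,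
      mul_nonneg (mul_nonneg (mul_nonneg (mul_nonneg (mul_nonneg (mul_nonneg (mul_nonneg (mul_nonneg hE1 hE2) hE2) hE2) hE2) hK.le) hK.le) hK.le) hK.le,
      mul_nonneg (mul_nonneg (mul_nonneg (mul_nonneg (mul_nonneg hE1 hE1) hK.le) hK.le) hK.le) hK.le,
      mul_nonneg (mul_nonneg (mul_nonneg (mul_nonneg (mul_nonneg hE1 hE1) hL2) hL2) hL2) hK.le,
      mul_nonneg (mul_nonneg (mul_nonneg (mul_nonneg (mul_nonneg hE1 hE1) hA3) hK.le) hK.le) hK.le,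
      mul_nonneg (mul_nonneg (mul_nonneg (mul_nonneg (mul_nonneg hE1 hE1) hChi) hL2) hL2) hK.le,
      mul_nonneg (mul_nonneg (mul_nonneg (mul_nonneg (mul_nonneg hE1 hE1) hClo) hK.le) hK.le) hK.le,
      mul_nonneg (mul_nonneg (mul_nonneg (mul_nonneg (mul_nonneg (mul_nonneg hE1 hE1) h31') hChi) hL2) hK.le) hK.le,
      mul_nonneg (mul_nonneg (mul_nonneg (mul_nonneg (mul_nonneg (mul_nonneg hE1 hE1) h21') hChi) hL2) hK.le) hK.le,
      mul_nonneg (mul_nonneg (mul_nonneg (mul_nonneg (mul_nonneg (mul_nonneg hE1 hE1) hE3) hA2) hL2) hK.le) hK.le,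
      mul_nonneg (mul_nonneg (mul_nonneg (mul_nonneg (mul_nonneg (mul_nonneg hE1 hE1) hE3) hChi) hK.le) hK.le) hK.le,
      mul_nonneg (mul_nonneg (mul_nonneg (mul_nonneg (mul_nonneg (mul_nonneg hE1 hE1) hE3) hClo) hChi) hK.le) hK.le,
      mul_nonneg (mul_nonneg (mul_nonneg (mul_nonneg (mul_nonneg (mul_nonneg hE1 hE1) hE2) hA3) hL2) hK.le) hK.le,
      mul_nonneg (mul_nonneg (mul_nonneg (mul_nonneg (mul_nonneg (mul_nonneg hE1 hE1) hE2) hChi) hK.le) hK.le) hK.le,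
      mul_nonneg (mul_nonneg (mul_nonneg (mul_nonneg (mul_nonneg (mul_nonneg hE1 hE1) hE2) hClo) hChi) hK.le) hK.le,
      mul_nonneg (mul_nonneg (mul_nonneg (mul_nonneg (mul_nonneg (mul_nonneg (mul_nonneg hE1 hE1) hE2) hE3) hClo) hK.le) hK.le) hK.le,
      mul_nonneg (mul_nonneg (mul_nonneg (mul_nonneg (mul_nonneg (mul_nonneg (mul_nonneg hE1 hE1) hE2) hE3) hClo) hClo) hK.le) hK.le,
      mul_nonneg (mul_nonneg (mul_nonneg (mul_nonneg (mul_nonneg (mul_nonneg (mul_nonneg hE1 hE1) hE1) h31') hL2) hK.le) hK.le) hK.le,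
      mul_nonneg (mul_nonneg (mul_nonneg (mul_nonneg (mul_nonneg (mul_nonneg (mul_nonneg hE1 hE1) hE1) h21') hL2) hK.le) hK.le) hK.le,
      mul_nonneg (mul_nonneg (mul_nonneg (mul_nonneg (mul_nonneg (mul_nonneg (mul_nonneg hE1 hE1) hE1) hE3) hK.le) hK.le) hK.le) hK.le,
      mul_nonneg (mul_nonneg (mul_nonneg (mul_nonneg (mul_nonneg (mul_nonneg (mul_nonneg hE1 hE1) hE1) hE3) hClo) hK.le) hK.le) hK.le,
      mul_nonneg (mul_nonneg (mul_nonneg (mul_nonneg (mul_nonneg (mul_nonneg (mul_nonneg hE1 hE1) hE1) hE2) hK.le) hK.le) hK.le) hK.le,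
      mul_nonneg (mul_nonneg (mul_nonneg (mul_nonneg (mul_nonneg (mul_nonneg (mul_nonneg hE1 hE1) hE1) hE2) hClo) hK.le) hK.le) hK.le,
      mul_nonneg (mul_nonneg (mul_nonneg (mul_nonneg (mul_nonneg (mul_nonneg (mul_nonneg hE1 hE1) hE1) hE1) hK.le) hK.le) hK.le) hK.le,
      mul_nonneg (mul_nonneg (mul_nonneg (mul_nonneg (mul_nonneg (mul_nonneg (mul_nonneg hE1 hE1) hE1) hE1) hA3) hK.le) hK.le) hK.le,
      mul_nonneg (mul_nonneg (mul_nonneg (mul_nonneg (mul_nonneg (mul_nonneg (mul_nonneg hE1 hE1) hE1) hE1) hA2) hK.le) hK.le) hK.le,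
      mul_nonneg (mul_nonneg (mul_nonneg (mul_nonneg hA1 h31') hL2) hL2) hK.le,
      mul_nonneg (mul_nonneg (mul_nonneg (mul_nonneg hA1 h31') hA3) hA3) hL2,
      mul_nonneg (mul_nonneg (mul_nonneg (mul_nonneg (mul_nonneg hA1 h31') h31') hL2) hK.le) hK.le,
      mul_nonneg (mul_nonneg (mul_nonneg (mul_nonneg hA1 h21') hL2) hL2) hK.le,
      mul_nonneg (mul_nonneg (mul_nonneg (mul_nonneg hA1 h21') hA2) hA2) hL2,
      mul_nonneg (mul_nonneg (mul_nonneg (mul_nonneg (mul_nonneg hA1 h21') h21') hL2) hK.le) hK.le,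
      mul_nonneg (mul_nonneg (mul_nonneg (mul_nonneg (mul_nonneg hA1 h21') h21') hA3) hA3) hK.le,
      mul_nonneg (mul_nonneg (mul_nonneg (mul_nonneg (mul_nonneg hA1 hE3) hE3) hA2) hK.le) hK.le,
      mul_nonneg (mul_nonneg (mul_nonneg (mul_nonneg (mul_nonneg hA1 hE2) hE2) hA3) hK.le) hK.le,
      mul_nonneg (mul_nonneg (mul_nonneg (mul_nonneg (mul_nonneg hA1 hE1) hE1) hK.le) hK.le) hK.le,
      mul_nonneg (mul_nonneg (mul_nonneg (mul_nonneg hA1 hA1) h31') hL2) hL2,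
      mul_nonneg (mul_nonneg (mul_nonneg (mul_nonneg hA1 hA1) h21') hL2) hL2,
      mul_nonneg (mul_nonneg (mul_nonneg (mul_nonneg hA1 hA1) hE1) hL2) hL2]
  by_contra hc; push Not at hc
  have := mul_neg_of_pos_of_neg hK (show ((3 * lo + K * (g₁ + g₂ + g₃)) * (lo + K) - (lo + K * g₁) * (6 * lo + 2 * K)) * ((1 - g₁) * (1 - g₂) * (1
          - g₃) * (3 * lo + 2 * K) + (g₁ * (1 - g₂) * (1 - g₃) + g₂ * (1 - g₁) * (1 - g₃) + g₃ * (1 - g₁) * (1 - g₂)) * (3 * lo + K) + (g₁ * g₂ * (1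
          - g₃) + g₁ * g₃ * (1 - g₂) + g₂ * g₃ * (1 - g₁)) * (3 * lo)) - ((K - 3 * lo) * (lo + K * g₁) * (6 * lo + 2 * K) * ((1 - g₁) * (1 - g₂) * (1 - g₃) + (g₁ * (1 - g₂) * (1 - g₃) + g₂ * (1 - g₁) * (1 - g₃) + g₃ * (1 - g₁) * (1 - g₂)))) < 0 by linarith)
  linarith

end LawDec
end Quant
end Summit.CriticalPhenomena.PercolationContinuityZ3.Theorems
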